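import Literature.NumberTheory.LFunctions.WeilFirstPrimeOddMarginDataD
import Literature.NumberTheory.LFunctions.WeilBlockRows
import HarnessLib

/-!
# Odd-sector margin certificate D: dominance of rows 15–19 of `R = S'_odd(κ') − UᵀU`

Part of the odd-block check of `weilCertOddD` (`WeilFirstPrimeOddMarginDataD.lean`), evaluated by `decide +kernel`
row by row (`WeilCert.checkDomRow`, `WeilBlockRows.lean`) and kept in its own file for kernel time and memory.
Assembled in `WeilFirstPrimeOddMarginDCheck.lean`. Pure proof file; nothing is asserted.
-/

noncomputable section

namespace Literature.NumberTheory.LFunctions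

set_option maxHeartbeats 0 in
/-- Kernel check of the dominance of row 15 of `R = S'_odd(κ') − UᵀU` (certificate D). [folklore] -/
theorem checkDomRow1_15_weilCertOddD :
    weilCertOddD.base.checkDomRow weilCertOddD.nuTab weilCertOddDKappa' 1 15 = true := by
  decide +kernel

set_option maxHeartbeats 0 in
/-- Kernel check of the dominance of row 16 of `R = S'_odd(κ') − UᵀU` (certificate D). [folklore] -/
theorem checkDomRow1_16_weilCertOddD :
    weilCertOddD.base.checkDomRow weilCertOddD.nuTab weilCertOddDKappa' 1 16 = true := by
  decide +kernel

set_option maxHeartbeats 0 in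
/-- Kernel check of the dominance of row 17 of `R = S'_odd(κ') − UᵀU` (certificate D). [folklore] -/
theorem checkDomRow1_17_weilCertOddD :
    weilCertOddD.base.checkDomRow weilCertOddD.nuTab weilCertOddDKappa' 1 17 = true := by
  decide +kernel

set_option maxHeartbeats 0 in
/-- Kernel check of the dominance of row 18 of `R = S'_odd(κ') − UᵀU` (certificate D). [folklore] -/
theorem checkDomRow1_18_weilCertOddD :
    weilCertOddD.base.checkDomRow weilCertOddD.nuTab weilCertOddDKappa' 1 18 = true := by
  decide +kernel

set_option maxHeartbeats 0 in
/-- Kernel check of the dominance of row 19 of `R = S'_odd(κ') − UᵀU` (certificate D). [folklore] -/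
theorem checkDomRow1_19_weilCertOddD :
    weilCertOddD.base.checkDomRow weilCertOddD.nuTab weilCertOddDKappa' 1 19 = true := by
  decide +kernel

end Literature.NumberTheory.LFunctions
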